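import Mathlib
import Summits.NavierStokesRegularity.NavierStokesRegularity.Theorems.OrthantWakeDyadicBreakBelowOneTransport
import HarnessLib

/-!
# `OrthantWake.DyadicBreakBelowOne` — certificates on an INTERVAL of shell ratios: rational
# enclosures of the drain and clock ratio, and the relaxed polynomial certificate

Item stmt-NavierStokesRegularity-24644 (`OrthantWake.DyadicBreakBelowOne`, aside).  To certify the
cubic 2-mode region for EVERY ratio `b = 1+ε₀` in an interval `ε₀ ∈ [e₁, e₂]` (`e₁ ≥ 0`) at once, with
the weight `w = 51/100` (so `D = b^{97/100}`, `K = b^{199/100}`, `V = b²`), we enclose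
`D ∈ [(1+e₁)/(1 + 3e₂/100), 1+e₂]`, `K ∈ [(1+e₁)²/(1 + e₂/100), (1+e₂)²]`, `V ≤ (1+e₂)²` (Bernoulli's
inequality for real exponents `≤ 1`) and replace `D, K, V` monotonically in the four certificate
facts.  The result `not_noGlobalCascade_dyadicTable_of_enclosure` turns two one-variable
polynomial inequalities with RATIONAL coefficients (depending only on `e₁, e₂` and the region
parameters `δ, θ, m, c`) plus two rational numerical conditions into
`∀ ε₀ ∈ [e₁, e₂], ∀ X₀, ¬ NoGlobalCascade ε₀ dyadicTable X₀`.

MODEL lattice statements (route OrthantWake, rung TL-M2Break); nothing here is a statement about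
the Navier–Stokes equations; no crux or summit is proved.
-/

noncomputable section

set_option linter.dupNamespace false

namespace Summit.NavierStokesRegularity.NavierStokesRegularity.Theorems

open Set
open Literature.Analysis.FluidPDE.TaoCascade

/-- **Enclosure of the drain `D = (1+ε₀)^{97/100}`** for `0 ≤ e₁ ≤ ε₀ ≤ e₂`:
`(1+e₁)/(1 + 3e₂/100) ≤ D ≤ 1 + e₂` (Bernoulli: `(1+ε₀)^{3/100} ≤ 1 + 3ε₀/100`). [this file] -/
theorem dyadicEnclosure_D {ε₀ e₁ e₂ : ℝ} (he₁ : 0 ≤ e₁) (h₁ : e₁ ≤ ε₀) (h₂ : ε₀ ≤ e₂) :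
    (1 + e₁) / (1 + 3 / 100 * e₂) ≤ (1 + ε₀) ^ ((5 : ℝ) / 2 - 3 * (51 / 100)) ∧
      (1 + ε₀) ^ ((5 : ℝ) / 2 - 3 * (51 / 100)) ≤ 1 + e₂ := by
  have hb : (0 : ℝ) < 1 + ε₀ := by linarith
  have e2 : ((5 : ℝ) / 2 - 3 * (51 / 100)) = 1 - 3 / 100 := by norm_num
  rw [e2, Real.rpow_sub hb, Real.rpow_one]
  have hsmall : (1 + ε₀) ^ ((3 : ℝ) / 100) ≤ 1 + (3 : ℝ) / 100 * ε₀ :=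
    rpow_one_add_le_one_add_mul_self (by linarith) (by norm_num) (by norm_num)
  have hpos : (0 : ℝ) < (1 + ε₀) ^ ((3 : ℝ) / 100) := Real.rpow_pos_of_pos hb _
  have hge1 : (1 : ℝ) ≤ (1 + ε₀) ^ ((3 : ℝ) / 100) := Real.one_le_rpow (by linarith) (by norm_num)
  constructor
  · rw [div_le_div_iff₀ (by linarith) hpos]
    nlinarith
  · rw [div_le_iff₀ hpos]
    nlinarith

/-- **Enclosure of the clock ratio `K = (1+ε₀)^{199/100}`** for `0 ≤ e₁ ≤ ε₀ ≤ e₂`: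
`(1+e₁)²/(1 + e₂/100) ≤ K ≤ (1+e₂)²`. [this file] -/
theorem dyadicEnclosure_K {ε₀ e₁ e₂ : ℝ} (he₁ : 0 ≤ e₁) (h₁ : e₁ ≤ ε₀) (h₂ : ε₀ ≤ e₂) :
    (1 + e₁) ^ 2 / (1 + 1 / 100 * e₂) ≤ (1 + ε₀) ^ ((5 : ℝ) / 2 - 51 / 100) ∧
      (1 + ε₀) ^ ((5 : ℝ) / 2 - 51 / 100) ≤ (1 + e₂) ^ 2 := by
  have hb : (0 : ℝ) < 1 + ε₀ := by linarith
  have e2 : ((5 : ℝ) / 2 - 51 / 100) = 2 - 1 / 100 := by norm_num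
  have e3 : (1 + ε₀) ^ (2 : ℝ) = (1 + ε₀) ^ 2 := Real.rpow_two _
  rw [e2, Real.rpow_sub hb, e3]
  have hsmall : (1 + ε₀) ^ ((1 : ℝ) / 100) ≤ 1 + (1 : ℝ) / 100 * ε₀ :=
    rpow_one_add_le_one_add_mul_self (by linarith) (by norm_num) (by norm_num)
  have hpos : (0 : ℝ) < (1 + ε₀) ^ ((1 : ℝ) / 100) := Real.rpow_pos_of_pos hb _
  have hge1 : (1 : ℝ) ≤ (1 + ε₀) ^ ((1 : ℝ) / 100) := Real.one_le_rpow (by linarith) (by norm_num)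
  have hsq1 : (1 + e₁) ^ 2 ≤ (1 + ε₀) ^ 2 := by nlinarith
  have hsq2 : (1 + ε₀) ^ 2 ≤ (1 + e₂) ^ 2 := by nlinarith
  constructor
  · rw [div_le_div_iff₀ (by linarith) hpos]
    nlinarith
  · rw [div_le_iff₀ hpos]
    nlinarith

/-- **Interval certificate ⇒ no Theorem 4.2-level blow-up on the whole interval of ratios.**
For `0 ≤ e₁ ≤ ε₀ ≤ e₂`, `ε₀ > 0`, weight `w = 51/100`, region parameters `0 < δ < θ ≤ 1`,
`m ≥ 0`, `c > 0` with the RATIONAL conditions: corner `(1+e₁)/(1+3e₂/100) · c ≥ 1`, star-shape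
`(1+e₂)²(1−δ) ≤ 3`, and the two relaxed one-variable inequalities `hP1` (slanted piece) and `hP2`
(curved piece) in which `D, K, V` are replaced by the enclosures of `dyadicEnclosure_D/K` in the
monotone direction — then `∀ X₀, ¬ NoGlobalCascade ε₀ dyadicTable X₀`
(`not_noGlobalCascade_dyadicTable_of_certificate`). MODEL lattice statement. [this file] -/
theorem not_noGlobalCascade_dyadicTable_of_enclosure {ε₀ e₁ e₂ δ θ m c : ℝ}
    (hε₀ : 0 < ε₀) (he₁ : 0 ≤ e₁) (h₁ : e₁ ≤ ε₀) (h₂ : ε₀ ≤ e₂)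
    (hδ0 : 0 < δ) (hδθ : δ < θ) (hθ1 : θ ≤ 1) (hm : 0 ≤ m) (hc0 : 0 < c)
    (hcorner : 1 ≤ (1 + e₁) / (1 + 3 / 100 * e₂) * c)
    (hstar : (1 + e₂) ^ 2 * (1 - δ) ≤ 3)
    (hP1 : ∀ x : ℝ, 0 ≤ x → m * x + θ ≤ 1 →
      (1 + e₂) ^ 2 * x ^ 2 -
          (1 + e₁) ^ 2 / (1 + 1 / 100 * e₂) * ((1 + e₁) / (1 + 3 / 100 * e₂)) *
            ((m * x + θ) * (c * ((m * x + θ - δ) / (1 - δ)) ^ 3)) +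
        m * (1 + e₂) * (x * (m * x + θ)) ≤ 0)
    (hP2 : ∀ x : ℝ, δ < x → x ≤ 1 →
      3 * c * ((x - δ) / (1 - δ)) ^ 2 / (1 - δ) *
            (1 - (1 + e₁) / (1 + 3 / 100 * e₂) * x * (c * ((x - δ) / (1 - δ)) ^ 3)) -
          (1 + e₁) ^ 2 / (1 + 1 / 100 * e₂) * x ^ 2 +
        (1 + e₂) ^ 2 * (1 + e₂) *
          ((c * ((x - δ) / (1 - δ)) ^ 3) * (m * (c * ((x - δ) / (1 - δ)) ^ 3) + θ)) < 0) :
    ∀ X₀ : Fin 4 → ℝ, ¬ NoGlobalCascade ε₀ dyadicTable X₀ := by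
  obtain ⟨hDlo, hDhi⟩ := dyadicEnclosure_D he₁ h₁ h₂
  obtain ⟨hKlo, hKhi⟩ := dyadicEnclosure_K he₁ h₁ h₂
  set D := (1 + ε₀) ^ ((5 : ℝ) / 2 - 3 * (51 / 100)) with hD
  set K := (1 + ε₀) ^ ((5 : ℝ) / 2 - 51 / 100) with hK
  set Dlo := (1 + e₁) / (1 + 3 / 100 * e₂) with hDlo'
  set Klo := (1 + e₁) ^ 2 / (1 + 1 / 100 * e₂) with hKlo'
  have hDlo0 : 0 < Dlo := by rw [hDlo']; exact div_pos (by linarith) (by linarith)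
  have hKlo0 : 0 < Klo := by rw [hKlo']; exact div_pos (pow_pos (by linarith) 2) (by linarith)
  have hD0 : 0 < D := hDlo0.trans_le hDlo
  have hK0 : 0 < K := hKlo0.trans_le hKlo
  have hδ1 : δ < 1 := hδθ.trans_le hθ1
  have h1δ : 0 < 1 - δ := by linarith
  refine not_noGlobalCascade_dyadicTable_of_certificate (w := 51 / 100) hε₀ (by norm_num)
    (by norm_num) hδ0 hδθ hθ1 hm hc0 ?_ ?_ ?_ ?_
  · -- corner
    exact hcorner.trans (mul_le_mul_of_nonneg_right hDlo hc0.le)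
  · -- star-shape
    have hV : (1 + ε₀) ^ (2 : ℝ) ≤ (1 + e₂) ^ 2 := by
      rw [Real.rpow_two]; nlinarith
    exact (mul_le_mul_of_nonneg_right hV h1δ.le).trans hstar
  · -- ψ₁
    intro x hx0 hx1
    set g : ℝ := m * x + θ with hg
    have hg0 : 0 ≤ g := by rw [hg]; nlinarith
    have hgδ : 0 ≤ (g - δ) / (1 - δ) := by rw [hg]; apply div_nonneg <;> nlinarith
    set hval : ℝ := c * ((g - δ) / (1 - δ)) ^ 3 with hh
    have hh0 : 0 ≤ hval := by rw [hh]; positivity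
    have hpoly := hP1 x hx0 hx1
    have e1 : K * x ^ 2 ≤ (1 + e₂) ^ 2 * x ^ 2 := mul_le_mul_of_nonneg_right hKhi (sq_nonneg x)
    have e2 : Klo * Dlo * (g * hval) ≤ K * D * (g * hval) :=
      mul_le_mul_of_nonneg_right (mul_le_mul hKlo hDlo hDlo0.le hK0.le) (mul_nonneg hg0 hh0)
    have e3 : m * D * (x * g) ≤ m * (1 + e₂) * (x * g) :=
      mul_le_mul_of_nonneg_right (mul_le_mul_of_nonneg_left hDhi hm) (mul_nonneg hx0 hg0)
    have key : K * (x ^ 2 - D * g * hval) + m * D * x * g =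
        K * x ^ 2 - K * D * (g * hval) + m * D * (x * g) := by ring
    rw [key]
    linarith
  · -- ψ₂
    intro x hx0 hx1
    set u : ℝ := (x - δ) / (1 - δ) with hu
    have hu0 : 0 ≤ u := by rw [hu]; apply div_nonneg <;> linarith
    set hval : ℝ := c * u ^ 3 with hh
    have hh0 : 0 ≤ hval := by rw [hh]; positivity
    set hder : ℝ := 3 * c * u ^ 2 / (1 - δ) with hhd
    have hhd0 : 0 ≤ hder := by rw [hhd]; positivity
    have hx0' : 0 ≤ x := by linarith
    have hθ0 : 0 ≤ θ := by linarith
    have hpoly := hP2 x hx0 hx1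
    have e1 : hder * (1 - D * x * hval) ≤ hder * (1 - Dlo * x * hval) := by
      apply mul_le_mul_of_nonneg_left _ hhd0
      nlinarith [mul_le_mul_of_nonneg_right hDlo (mul_nonneg hx0' hh0)]
    have e2 : Klo * x ^ 2 ≤ K * x ^ 2 := mul_le_mul_of_nonneg_right hKlo (sq_nonneg x)
    have e3 : K * D * (hval * (m * hval + θ)) ≤ (1 + e₂) ^ 2 * (1 + e₂) * (hval * (m * hval + θ)) :=
      mul_le_mul_of_nonneg_right (mul_le_mul hKhi hDhi hD0.le (by positivity))
        (mul_nonneg hh0 (by positivity))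
    have key : hder * (1 - D * x * hval) - K * (x ^ 2 - D * hval * (m * hval + θ)) =
        hder * (1 - D * x * hval) - K * x ^ 2 + K * D * (hval * (m * hval + θ)) := by ring
    rw [key]
    linarith

end Summit.NavierStokesRegularity.NavierStokesRegularity.Theorems

end
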